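import Summits.CriticalPhenomena.Ising3DConformalLimit.Theorems.ArmDressingArmDressingGlueInvSystems
import Literature.Probability.LatticeModels.HighDimPointwiseTriviality
import HarnessLib

/-!
# Route `ArmDressing`, crux `ArmDressingGlue` (stmt-CriticalPhenomena-15700): stub `stub_twoBallPositive`

Line `registered`, skeleton v3, the lead's stub: for two DISJOINT closed balls of `ℝ³` the infinite-volume critical
FK-Ising probability that their mesh-`δ` discretisations are connected stays bounded away from `0` as `δ → 0⁺`,
GIVEN (hypotheses, proved by the other stubs of the line from cruxes B ∧ C): the second-moment inequality
`(Σ_{X×Y} G)² ≤ Pr[X ↔ Y]·Σ(GG+GG+GG)` (pair count + Edwards–Sokal + Lebowitz), the range `0 < a(K) ≤ 1` of the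
one-arm probability `a(K) = arm1 K⁻¹ 1`, and the box estimates `G ≥ c'a(M)²` on `Λ_M`, `Σ_{Λ_M} G ≤ C'M³a(M)²`.
Proof: one common scale `M = ⌈R/δ⌉₊`, `R = 2rₐ + 2r_b + ‖a-b‖`, holds all differences of points of `A^δ ∪ B^δ`,
so `ΣG ≥ #A^δ#B^δ c'a(M)²`, `χ_{A^δ} ≤ #A^δ C'M³a(M)²`; the pairing sum is `2(ΣG)² + χχ` and
`χχ/(ΣG)² ≤ (C'/c')²M⁶/(#A^δ#B^δ) ≤ (C'/c')²((R+1)/h)⁶` (a lattice cube of side `≍ h/δ`, `h = min(rₐ,r_b)/2`, fits in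
each disc), whence `Pr ≥ 1/(2 + (C'/c')²((R+1)/h)⁶)` — the 3D replacement, by a second-moment count, of the RSW
input of Camia–Feng's planar bookkeeping (arXiv:2411.01467 §3.2.2).
-/

noncomputable section

namespace Summit.CriticalPhenomena.Ising3DConformalLimit.Cruxes.ArmDressingGlue.CrossPos

open scoped BigOperators Topology
open Filter Set Metric
open Literature.Probability.LatticeModels Literature.Probability.Percolation Literature.Barriers.CriticalPhenomena
open Summit.CriticalPhenomena.Ising3DConformalLimit.Cruxes.ArmDressingGlue.Vocab

local notation "E3" => EuclideanSpace ℝ (Fin 3)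

/-! ### Finset algebra: the four-fold pairing sum -/

/-- The four-fold pairing sum of a symmetric kernel splits as `S·S + χ_X·χ_Y + S·S`
(`S = Σ_{X×Y} G`, `χ_X = Σ_{X×X} G`). [folklore] -/
theorem sum_pairings_eq (X Y : Finset (Site 3)) (G : Site 3 → Site 3 → ℝ) (hG : ∀ u v, G u v = G v u) :
    ∑ x ∈ X, ∑ y ∈ Y, ∑ x' ∈ X, ∑ y' ∈ Y, (G x y * G x' y' + G x x' * G y y' + G x y' * G y x') =
      (∑ x ∈ X, ∑ y ∈ Y, G x y) * (∑ x ∈ X, ∑ y ∈ Y, G x y) +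
        (∑ x ∈ X, ∑ x' ∈ X, G x x') * (∑ y ∈ Y, ∑ y' ∈ Y, G y y') +
        (∑ x ∈ X, ∑ y ∈ Y, G x y) * (∑ x ∈ X, ∑ y ∈ Y, G x y) := by
  have h1 : ∑ x ∈ X, ∑ y ∈ Y, ∑ x' ∈ X, ∑ y' ∈ Y, G x y * G x' y' =
      (∑ x ∈ X, ∑ y ∈ Y, G x y) * (∑ x ∈ X, ∑ y ∈ Y, G x y) := by
    rw [Finset.sum_mul]
    refine Finset.sum_congr rfl fun x _ => ?_
    rw [Finset.sum_mul]
    refine Finset.sum_congr rfl fun y _ => ?_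
    rw [Finset.mul_sum]
    refine Finset.sum_congr rfl fun x' _ => ?_
    rw [Finset.mul_sum]
  have h2 : ∑ x ∈ X, ∑ y ∈ Y, ∑ x' ∈ X, ∑ y' ∈ Y, G x x' * G y y' =
      (∑ x ∈ X, ∑ x' ∈ X, G x x') * (∑ y ∈ Y, ∑ y' ∈ Y, G y y') := by
    have inner : ∀ x y, ∑ x' ∈ X, ∑ y' ∈ Y, G x x' * G y y' =
        (∑ x' ∈ X, G x x') * (∑ y' ∈ Y, G y y') := fun x y => (Finset.sum_mul_sum _ _ _ _).symm
    simp_rw [inner]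
    rw [Finset.sum_mul]
    refine Finset.sum_congr rfl fun x _ => ?_
    rw [Finset.mul_sum]
  have h3 : ∑ x ∈ X, ∑ y ∈ Y, ∑ x' ∈ X, ∑ y' ∈ Y, G x y' * G y x' =
      (∑ x ∈ X, ∑ y ∈ Y, G x y) * (∑ x ∈ X, ∑ y ∈ Y, G x y) := by
    have inner : ∀ x y, ∑ x' ∈ X, ∑ y' ∈ Y, G x y' * G y x' =
        (∑ y' ∈ Y, G x y') * (∑ x' ∈ X, G y x') := by
      intro x y
      rw [Finset.sum_comm, Finset.sum_mul_sum]
    simp_rw [inner]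
    have hS' : ∑ y ∈ Y, ∑ x' ∈ X, G y x' = ∑ x ∈ X, ∑ y ∈ Y, G x y := by
      rw [Finset.sum_comm]
      exact Finset.sum_congr rfl fun x _ => Finset.sum_congr rfl fun y _ => hG y x
    calc ∑ x ∈ X, ∑ y ∈ Y, (∑ y' ∈ Y, G x y') * ∑ x' ∈ X, G y x'
        = ∑ x ∈ X, (∑ y' ∈ Y, G x y') * ∑ y ∈ Y, ∑ x' ∈ X, G y x' := by
          refine Finset.sum_congr rfl fun x _ => ?_
          rw [Finset.mul_sum]
      _ = (∑ x ∈ X, ∑ y' ∈ Y, G x y') * ∑ y ∈ Y, ∑ x' ∈ X, G y x' := by rw [Finset.sum_mul]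
      _ = _ := by rw [hS']
  simp only [Finset.sum_add_distrib, h1, h2, h3]

/-! ### Lattice geometry of discretised balls -/

/-- Coordinates of differences of lattice points whose mesh-`δ` images are within Euclidean distance `R` are at
most `⌈R/δ⌉₊` in absolute value: the difference lies in the box `Λ_{⌈R/δ⌉₊}`. [folklore] -/
theorem sub_mem_box_of_norm_le {δ R : ℝ} (hδ : 0 < δ) {x y : Site 3} (h : ‖mesh δ y - mesh δ x‖ ≤ R) :
    y - x ∈ box 3 ⌈R / δ⌉₊ := by
  rw [mem_box_iff_supNorm_le, Site.supNorm_le_iff]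
  intro i
  have hi : |(mesh δ y - mesh δ x) i| ≤ R := le_trans (by
    simpa only [Real.norm_eq_abs] using PiLp.norm_apply_le (mesh δ y - mesh δ x) i) h
  have hcoord : (mesh δ y - mesh δ x) i = δ * ((y i : ℝ) - (x i : ℝ)) := by
    simp only [PiLp.sub_apply, mesh_apply]; ring
  rw [hcoord, abs_mul, abs_of_pos hδ] at hi
  have hR : |((y i : ℝ) - (x i : ℝ))| ≤ R / δ := by
    rw [le_div_iff₀ hδ, mul_comm]; exact hi
  have hceil : |((y i : ℝ) - (x i : ℝ))| ≤ (⌈R / δ⌉₊ : ℝ) := hR.trans (Nat.le_ceil _)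
  have hint : (((y - x) i).natAbs : ℤ) ≤ (⌈R / δ⌉₊ : ℤ) := by
    rw [Int.natCast_natAbs, Pi.sub_apply]
    have : (|((y i - x i : ℤ) : ℝ)|) ≤ ((⌈R / δ⌉₊ : ℤ) : ℝ) := by
      push_cast; exact hceil
    exact_mod_cast this
  exact_mod_cast hint

/-- Two points of a closed ball are within twice the radius. [folklore] -/
theorem norm_sub_le_of_mem_closedBall {a u v : E3} {r : ℝ} (hu : u ∈ closedBall a r) (hv : v ∈ closedBall a r) :
    ‖v - u‖ ≤ 2 * r := by
  rw [mem_closedBall, dist_eq_norm] at hu hv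
  calc ‖v - u‖ = ‖(v - a) - (u - a)‖ := by congr 1; abel
    _ ≤ ‖v - a‖ + ‖u - a‖ := norm_sub_le _ _
    _ ≤ 2 * r := by linarith

/-- Points of two closed balls are within `rₐ + r_b + ‖a - b‖`. [folklore] -/
theorem norm_sub_le_of_mem_closedBall_two {a b u v : E3} {ra rb : ℝ} (hu : u ∈ closedBall a ra)
    (hv : v ∈ closedBall b rb) : ‖v - u‖ ≤ ra + rb + ‖a - b‖ := by
  rw [mem_closedBall, dist_eq_norm] at hu hv
  calc ‖v - u‖ = ‖(v - b) + (b - a) - (u - a)‖ := by congr 1; abel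
    _ ≤ ‖(v - b) + (b - a)‖ + ‖u - a‖ := norm_sub_le _ _
    _ ≤ ‖v - b‖ + ‖b - a‖ + ‖u - a‖ := by gcongr; exact norm_add_le _ _
    _ = ‖v - b‖ + ‖a - b‖ + ‖u - a‖ := by rw [norm_sub_rev b a]
    _ ≤ ra + rb + ‖a - b‖ := by linarith

/-- **A lattice cube inside a discretised ball.**  For `0 < δ ≤ h` with `h = r/2`, the disc of the closed ball
`B̄(a, r)` contains at least `(h/δ)³` lattice points (the cube of integer side `⌊2h/δ⌋₊ ≥ h/δ` whose mesh image
lies in the coordinate cube of half-width `h` around `a`, itself inside the ball since `3h² ≤ r²`). [folklore] -/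
theorem cube_card_le_disc {δ r : ℝ} (hδ : 0 < δ) (hr : 0 < r) (hδh : δ ≤ r / 2) (a : E3)
    (F : Finset (Site 3)) (hF : ∀ x, x ∈ F ↔ x ∈ disc δ (closedBall a r)) :
    (r / 2 / δ) ^ 3 ≤ (F.card : ℝ) := by
  set h : ℝ := r / 2 with hh
  have hhpos : 0 < h := by positivity
  set N : ℕ := ⌊2 * h / δ⌋₊ with hN
  set lo : Fin 3 → ℤ := fun i => ⌈(a i - h) / δ⌉ with hlo
  set T : Finset (Site 3) := Fintype.piFinset fun i => Finset.Icc (lo i) (lo i + N - 1) with hT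
  -- `N ≥ h/δ`
  have hNge : h / δ ≤ (N : ℝ) := by
    have h1 : (2 * h / δ : ℝ) < N + 1 := Nat.lt_floor_add_one _
    have h2 : 1 ≤ h / δ := by rw [le_div_iff₀ hδ, one_mul]; exact hδh
    have : 2 * h / δ = 2 * (h / δ) := by ring
    linarith
  -- card of the cube
  have hcardT : (T.card : ℝ) = (N : ℝ) ^ 3 := by
    have hI : ∀ i, (Finset.Icc (lo i) (lo i + N - 1)).card = N := fun i => by
      rw [Int.card_Icc]; omega
    have : T.card = N ^ 3 := by
      rw [hT, Fintype.card_piFinset]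
      simp_rw [hI]
      rw [Finset.prod_const, Finset.card_univ, Fintype.card_fin]
    rw [this]; push_cast; ring
  -- the cube lies in the disc
  have hTF : T ⊆ F := by
    intro x hx
    rw [hF, mem_disc, mem_closedBall, dist_eq_norm]
    rw [hT, Fintype.mem_piFinset] at hx
    have hcoord : ∀ i, |(mesh δ x - a) i| ≤ h := by
      intro i
      have hxi := Finset.mem_Icc.1 (hx i)
      have hlo1 : (a i - h) / δ ≤ (lo i : ℝ) := Int.le_ceil _
      have hlo2 : (lo i : ℝ) < (a i - h) / δ + 1 := Int.ceil_lt_add_one _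
      have hx1 : (lo i : ℝ) ≤ (x i : ℝ) := by exact_mod_cast hxi.1
      have hx2 : (x i : ℝ) ≤ (lo i : ℝ) + N - 1 := by
        have := hxi.2; exact_mod_cast this
      have hNle : (N : ℝ) ≤ 2 * h / δ := Nat.floor_le (by positivity)
      rw [PiLp.sub_apply, mesh_apply, abs_le]
      constructor
      · -- `a i - h ≤ δ x_i`
        have : (a i - h) / δ * δ = a i - h := div_mul_cancel₀ _ hδ.ne'
        nlinarith
      · -- `δ x_i ≤ a i + h`
        have e1 : (x i : ℝ) < (a i - h) / δ + 2 * h / δ := by linarith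
        have e2 : ((a i - h) / δ + 2 * h / δ) * δ = a i + h := by field_simp; ring
        nlinarith
    have hsq : ‖mesh δ x - a‖ ^ 2 ≤ r ^ 2 := by
      rw [EuclideanSpace.norm_eq, Real.sq_sqrt (Finset.sum_nonneg fun i _ => sq_nonneg _)]
      calc ∑ i, ‖(mesh δ x - a) i‖ ^ 2 ≤ ∑ _i : Fin 3, h ^ 2 := by
            refine Finset.sum_le_sum fun i _ => ?_
            rw [Real.norm_eq_abs]
            exact pow_le_pow_left₀ (abs_nonneg _) (hcoord i) 2
        _ = 3 * h ^ 2 := by simp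
        _ ≤ r ^ 2 := by rw [hh]; nlinarith
    exact le_of_pow_le_pow_left₀ two_ne_zero hr.le hsq
  have hcard : (T.card : ℝ) ≤ (F.card : ℝ) := by exact_mod_cast Finset.card_le_card hTF
  calc (r / 2 / δ) ^ 3 = (h / δ) ^ 3 := by rw [hh]
    _ ≤ (N : ℝ) ^ 3 := pow_le_pow_left₀ (by positivity) hNge 3
    _ = (T.card : ℝ) := hcardT.symm
    _ ≤ (F.card : ℝ) := hcard

/-- Row sums of the pair correlator over a finite set of lattice points whose mesh images are within distance `R`
of the base point are bounded by the box sum over `Λ_{⌈R/δ⌉₊}` (re-index `x' ↦ x' - x`, `G ≥ 0`). [folklore] -/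
theorem sum_row_le_box {δ R : ℝ} (hδ : 0 < δ) (X : Finset (Site 3)) (x : Site 3)
    (hX : ∀ x' ∈ X, ‖mesh δ x' - mesh δ x‖ ≤ R) :
    ∑ x' ∈ X, criticalCorr 3 2 ![x, x'] ≤ ∑ z ∈ box 3 ⌈R / δ⌉₊, criticalTwoPoint 3 z := by
  have h1 : ∑ x' ∈ X, criticalCorr 3 2 ![x, x'] = ∑ x' ∈ X, criticalTwoPoint 3 (x' - x) :=
    Finset.sum_congr rfl fun x' _ => criticalCorr_two_pair x x'
  rw [h1]
  have hinj : Set.InjOn (fun x' : Site 3 => x' - x) ↑X := fun u _ v _ huv => sub_left_injective huv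
  rw [← Finset.sum_image hinj]
  refine Finset.sum_le_sum_of_subset_of_nonneg ?_ fun z _ _ => criticalTwoPoint_nonneg' z
  intro z hz
  obtain ⟨x', hx', rfl⟩ := Finset.mem_image.1 hz
  exact sub_mem_box_of_norm_le hδ (hX x' hx')

/-- The two discretised closed balls form a probe family of finite sets (so `Pr` is a genuine probability).
[folklore] -/
theorem probes_two_closedBall_finite {δ : ℝ} (hδ : 0 < δ) (a b : E3) (ra rb : ℝ) :
    ∀ i, ((![disc δ (closedBall a ra), disc δ (closedBall b rb)] : Fin 2 → Set (Site 3)) i).Finite ∨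
      (((![disc δ (closedBall a ra), disc δ (closedBall b rb)] : Fin 2 → Set (Site 3)) i)ᶜ).Finite := by
  intro i
  fin_cases i
  · exact Or.inl (InvBook.finite_disc hδ isBounded_closedBall)
  · exact Or.inl (InvBook.finite_disc hδ isBounded_closedBall)

/-! ### The stub -/

/-- **Two-ball positivity** (registered stub `stub_twoBallPositive` of the skeleton of `ArmDressingGlue`, line
`registered` v3): from the second-moment inequality, the range of the one-arm probability and the box two-point
estimates in one-arm units, the critical FK-Ising probability that the discretisations of two disjoint closed balls
are connected is bounded below, eventually as `δ → 0⁺`, by `1/(2 + (|C'|/c')²((R+1)/h)⁶)` with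
`R = 2rₐ + 2r_b + ‖a-b‖`, `h = min(rₐ,r_b)/2` — the 3D replacement, by a second-moment count, of the RSW input of
the planar bookkeeping. [cite: CamiaFeng2025, §3.2.2] -/
theorem stub_twoBallPositive :
    (∀ (X Y : Finset (Site 3)), Disjoint X Y →
      (∑ x ∈ X, ∑ y ∈ Y, criticalCorr 3 2 ![x, y]) ^ 2 ≤
        Pr 2 ![(↑X : Set (Site 3)), ↑Y] {R | R 0 1} *
          ∑ x ∈ X, ∑ y ∈ Y, ∑ x' ∈ X, ∑ y' ∈ Y,
            (criticalCorr 3 2 ![x, y] * criticalCorr 3 2 ![x', y'] +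
              criticalCorr 3 2 ![x, x'] * criticalCorr 3 2 ![y, y'] +
              criticalCorr 3 2 ![x, y'] * criticalCorr 3 2 ![y, x'])) →
    ((∃ lam K₀ : ℝ, 0 < lam ∧ lam ^ 2 < 8 ∧ 0 < K₀ ∧
          ∀ K : ℝ, K₀ ≤ K → arm1 (K / 2)⁻¹ 1 ≤ lam * arm1 K⁻¹ 1) ∧
        (∀ K K' : ℝ, 0 < K → K ≤ K' → arm1 K'⁻¹ 1 ≤ arm1 K⁻¹ 1) ∧
        (∀ K : ℝ, 1 ≤ K → 0 < arm1 K⁻¹ 1 ∧ arm1 K⁻¹ 1 ≤ 1)) →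
    (∃ (c' C' : ℝ) (M₀ : ℕ), 0 < c' ∧ ∀ M : ℕ, M₀ ≤ M →
          (∀ y ∈ box 3 M, c' * arm1 (M : ℝ)⁻¹ 1 ^ 2 ≤ criticalTwoPoint 3 y) ∧
          ∑ y ∈ box 3 M, criticalTwoPoint 3 y ≤ C' * (M : ℝ) ^ 3 * arm1 (M : ℝ)⁻¹ 1 ^ 2) →
    ∀ (a b : E3) (ra rb : ℝ), 0 < ra → 0 < rb →
      Disjoint (Metric.closedBall a ra) (Metric.closedBall b rb) →
      ∃ c : ℝ, 0 < c ∧ ∀ᶠ δ in 𝓝[>] (0:ℝ),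
        c ≤ Pr 2 ![disc δ (Metric.closedBall a ra), disc δ (Metric.closedBall b rb)] {R | R 0 1} := by
  intro hSM hA hS a b ra rb hra hrb hdisj
  obtain ⟨-, -, hpos1⟩ := hA
  obtain ⟨c', C', M₀, hc', hbox⟩ := hS
  -- constants
  set h : ℝ := min ra rb / 2 with hh_def
  have hmin : 0 < min ra rb := lt_min hra hrb
  have hh : 0 < h := by positivity
  set R : ℝ := 2 * ra + 2 * rb + ‖a - b‖ with hR_def
  have hR : 0 < R := by positivity
  set C'' : ℝ := |C'| with hC''_def
  set B : ℝ := (C'' / c') ^ 2 * ((R + 1) / h) ^ 6 with hB_def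
  have hB : 0 ≤ B := by positivity
  refine ⟨1 / (2 + B), by positivity, ?_⟩
  have hε : 0 < min (min 1 h) (R / (M₀ + 1)) := by positivity
  filter_upwards [Ioo_mem_nhdsGT hε] with δ hδ
  obtain ⟨hδ0, hδε⟩ := hδ
  have hδ1 : δ < 1 := lt_of_lt_of_le hδε ((min_le_left _ _).trans (min_le_left _ _))
  have hδh : δ < h := lt_of_lt_of_le hδε ((min_le_left _ _).trans (min_le_right _ _))
  have hδM : δ < R / (M₀ + 1) := lt_of_lt_of_le hδε (min_le_right _ _)
  -- the finite discs
  obtain ⟨XF, hXF⟩ : ∃ XF : Finset (Site 3), ∀ x, x ∈ XF ↔ x ∈ disc δ (closedBall a ra) :=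
    ⟨(InvBook.finite_disc hδ0 isBounded_closedBall).toFinset, fun x => Set.Finite.mem_toFinset _⟩
  obtain ⟨YF, hYF⟩ : ∃ YF : Finset (Site 3), ∀ y, y ∈ YF ↔ y ∈ disc δ (closedBall b rb) :=
    ⟨(InvBook.finite_disc hδ0 isBounded_closedBall).toFinset, fun x => Set.Finite.mem_toFinset _⟩
  have hXcoe : (↑XF : Set (Site 3)) = disc δ (closedBall a ra) := Set.ext fun x => hXF x
  have hYcoe : (↑YF : Set (Site 3)) = disc δ (closedBall b rb) := Set.ext fun y => hYF y
  have hdisjF : Disjoint XF YF := by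
    rw [Finset.disjoint_left]
    intro x hx hy
    exact Set.disjoint_left.1 hdisj ((mem_disc _ _ _).1 ((hXF x).1 hx)) ((mem_disc _ _ _).1 ((hYF x).1 hy))
  -- the common scale `M = ⌈R/δ⌉₊`
  set M : ℕ := ⌈R / δ⌉₊ with hM_def
  have hRδ : R / δ ≤ (M : ℝ) := Nat.le_ceil _
  have hM₀R : (M₀ : ℝ) + 1 < R / δ := by
    rw [lt_div_iff₀ hδ0]
    have := hδM
    rw [lt_div_iff₀ (by positivity : (0:ℝ) < M₀ + 1)] at this
    linarith
  have hMM₀ : M₀ ≤ M := by exact_mod_cast (show (M₀ : ℝ) < M by linarith).le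
  have hM1 : (1 : ℝ) ≤ M := by linarith [(Nat.cast_nonneg M₀ : (0 : ℝ) ≤ M₀)]
  have hMle : (M : ℝ) ≤ (R + 1) / δ := by
    have h1 : (M : ℝ) < R / δ + 1 := Nat.ceil_lt_add_one (by positivity)
    have h2 : (1 : ℝ) ≤ 1 / δ := by rw [le_div_iff₀ hδ0, one_mul]; exact hδ1.le
    have h3 : (R + 1) / δ = R / δ + 1 / δ := by ring
    linarith
  obtain ⟨hlow, hup⟩ := hbox M hMM₀
  set aM : ℝ := arm1 (M : ℝ)⁻¹ 1 with haM_def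
  have haM : 0 < aM := (hpos1 M hM1).1
  -- abbreviations
  set G : Site 3 → Site 3 → ℝ := fun u v => criticalCorr 3 2 ![u, v] with hG_def
  have hGsymm : ∀ u v, G u v = G v u := fun u v => criticalCorr_two_pair_comm u v
  have hG0 : ∀ u v, 0 ≤ G u v := fun u v => by
    show 0 ≤ criticalCorr 3 2 ![u, v]
    rw [criticalCorr_two_pair]; exact criticalTwoPoint_nonneg' _
  set S : ℝ := ∑ x ∈ XF, ∑ y ∈ YF, G x y with hS_def
  set χX : ℝ := ∑ x ∈ XF, ∑ x' ∈ XF, G x x' with hχX_def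
  set χY : ℝ := ∑ y ∈ YF, ∑ y' ∈ YF, G y y' with hχY_def
  set P : ℝ := Pr 2 ![disc δ (closedBall a ra), disc δ (closedBall b rb)] {R | R 0 1} with hP_def
  have hP0 : 0 ≤ P := (InvBook.Pr_mem_Icc (probes_two_closedBall_finite hδ0 a b ra rb) _).1
  -- (1) the second-moment inequality for the two discs
  have hSMδ : S ^ 2 ≤ P * (S * S + χX * χY + S * S) := by
    have key := hSM XF YF hdisjF
    rw [hXcoe, hYcoe, sum_pairings_eq XF YF G hGsymm] at key
    exact key
  -- (2) counting: lattice cubes inside the discs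
  have hcube : ∀ (c₀ : E3) (r₀ : ℝ) (F : Finset (Site 3)), (∀ x, x ∈ F ↔ x ∈ disc δ (closedBall c₀ r₀)) →
      0 < r₀ → min ra rb ≤ r₀ → (h / δ) ^ 3 ≤ (F.card : ℝ) := by
    intro c₀ r₀ F hF hr₀ hle
    have h1 := cube_card_le_disc hδ0 hr₀ (by linarith [hδh.le]) c₀ F hF
    refine le_trans (pow_le_pow_left₀ (by positivity) ?_ 3) h1
    exact div_le_div_of_nonneg_right (by linarith) hδ0.le
  have hXcard : (h / δ) ^ 3 ≤ (XF.card : ℝ) := hcube a ra XF hXF hra (min_le_left ra rb)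
  have hYcard : (h / δ) ^ 3 ≤ (YF.card : ℝ) := hcube b rb YF hYF hrb (min_le_right ra rb)
  have hhδ : 0 < h / δ := by positivity
  have hXpos : (0 : ℝ) < XF.card := lt_of_lt_of_le (by positivity) hXcard
  have hYpos : (0 : ℝ) < YF.card := lt_of_lt_of_le (by positivity) hYcard
  -- (3) lower bound on `S`: every cross pair sits in the box `Λ_M`
  have hSlow : (XF.card : ℝ) * YF.card * (c' * aM ^ 2) ≤ S := by
    have hterm : ∀ x ∈ XF, ∀ y ∈ YF, c' * aM ^ 2 ≤ G x y := by
      intro x hx y hy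
      show c' * aM ^ 2 ≤ criticalCorr 3 2 ![x, y]
      rw [criticalCorr_two_pair]
      refine hlow (y - x) (sub_mem_box_of_norm_le hδ0 ?_)
      have hx' : mesh δ x ∈ closedBall a ra := (hXF x).1 hx
      have hy' : mesh δ y ∈ closedBall b rb := (hYF y).1 hy
      calc ‖mesh δ y - mesh δ x‖ ≤ ra + rb + ‖a - b‖ := norm_sub_le_of_mem_closedBall_two hx' hy'
        _ ≤ R := by rw [hR_def]; linarith
    calc (XF.card : ℝ) * YF.card * (c' * aM ^ 2) = ∑ _x ∈ XF, ∑ _y ∈ YF, c' * aM ^ 2 := by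
          rw [Finset.sum_const, nsmul_eq_mul, Finset.sum_const, nsmul_eq_mul]; ring
      _ ≤ S := Finset.sum_le_sum fun x hx => Finset.sum_le_sum fun y hy => hterm x hx y hy
  have hSpos : 0 < S := lt_of_lt_of_le (by positivity) hSlow
  -- (4) upper bounds on `χ_X`, `χ_Y`: rows are box sums
  have hM3 : 0 ≤ C'' * (M : ℝ) ^ 3 * aM ^ 2 := by positivity
  have hup' : ∑ z ∈ box 3 M, criticalTwoPoint 3 z ≤ C'' * (M : ℝ) ^ 3 * aM ^ 2 :=
    hup.trans (mul_le_mul_of_nonneg_right (mul_le_mul_of_nonneg_right (le_abs_self C') (by positivity))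
      (by positivity))
  have hrow : ∀ (c₀ : E3) (r₀ : ℝ) (F : Finset (Site 3)), (∀ x, x ∈ F ↔ x ∈ disc δ (closedBall c₀ r₀)) →
      2 * r₀ ≤ R → ∀ x ∈ F, ∑ x' ∈ F, G x x' ≤ C'' * (M : ℝ) ^ 3 * aM ^ 2 := by
    intro c₀ r₀ F hF hr₀ x hx
    have hX' : ∀ x' ∈ F, ‖mesh δ x' - mesh δ x‖ ≤ R := fun x' hx' =>
      (norm_sub_le_of_mem_closedBall ((hF x).1 hx) ((hF x').1 hx')).trans hr₀
    exact (sum_row_le_box hδ0 F x hX').trans hup'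
  have hRa : 2 * ra ≤ R := by rw [hR_def]; linarith [norm_nonneg (a - b)]
  have hRb : 2 * rb ≤ R := by rw [hR_def]; linarith [norm_nonneg (a - b)]
  have hrowX := hrow a ra XF hXF hRa
  have hrowY := hrow b rb YF hYF hRb
  have hχX : χX ≤ (XF.card : ℝ) * (C'' * (M : ℝ) ^ 3 * aM ^ 2) :=
    (Finset.sum_le_sum hrowX).trans (by rw [Finset.sum_const, nsmul_eq_mul])
  have hχY : χY ≤ (YF.card : ℝ) * (C'' * (M : ℝ) ^ 3 * aM ^ 2) :=
    (Finset.sum_le_sum hrowY).trans (by rw [Finset.sum_const, nsmul_eq_mul])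
  have hχX0 : 0 ≤ χX := Finset.sum_nonneg fun x _ => Finset.sum_nonneg fun x' _ => hG0 x x'
  have hχY0 : 0 ≤ χY := Finset.sum_nonneg fun y _ => Finset.sum_nonneg fun y' _ => hG0 y y'
  -- (5) the ratio bound `χ_X χ_Y ≤ B S²` (the scale `a(M)` cancels)
  have hhne : h ≠ 0 := hh.ne'
  have hc'ne : c' ≠ 0 := hc'.ne'
  have key : ((R + 1) / δ) ^ 6 = ((R + 1) / h) ^ 6 * ((h / δ) ^ 3 * (h / δ) ^ 3) := by
    have e1 : (h / δ) ^ 3 * (h / δ) ^ 3 = (h / δ) ^ 6 := by ring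
    have e2 : (R + 1) / δ = (R + 1) / h * (h / δ) := by
      rw [div_mul_div_comm, mul_comm (R + 1) h, mul_div_mul_left _ _ hhne]
    rw [e1, e2, mul_pow]
  have hM6 : (M : ℝ) ^ 6 ≤ ((R + 1) / δ) ^ 6 := pow_le_pow_left₀ (Nat.cast_nonneg _) hMle 6
  have hXY : (h / δ) ^ 3 * (h / δ) ^ 3 ≤ (XF.card : ℝ) * YF.card :=
    mul_le_mul hXcard hYcard (pow_nonneg hhδ.le 3) (Nat.cast_nonneg _)
  have hN0 : 0 ≤ (XF.card : ℝ) * YF.card := mul_nonneg (Nat.cast_nonneg _) (Nat.cast_nonneg _)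
  have hRh : 0 ≤ ((R + 1) / h) ^ 6 := pow_nonneg (div_nonneg (by linarith) hh.le) 6
  -- make the abbreviations opaque (cheap unification from here on)
  clear_value P S χX χY aM G M
  have haM4 : 0 ≤ aM ^ 4 := pow_nonneg haM.le 4
  have hC2 : 0 ≤ C'' ^ 2 := sq_nonneg _
  have hratio : χX * χY ≤ B * S ^ 2 := by
    have step1 : χX * χY ≤ ((XF.card : ℝ) * (C'' * (M : ℝ) ^ 3 * aM ^ 2)) *
        ((YF.card : ℝ) * (C'' * (M : ℝ) ^ 3 * aM ^ 2)) :=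
      mul_le_mul hχX hχY hχY0 (mul_nonneg (Nat.cast_nonneg _) hM3)
    have e0 : ((XF.card : ℝ) * (C'' * (M : ℝ) ^ 3 * aM ^ 2)) * ((YF.card : ℝ) * (C'' * (M : ℝ) ^ 3 * aM ^ 2))
        = C'' ^ 2 * (M : ℝ) ^ 6 * aM ^ 4 * ((XF.card : ℝ) * YF.card) := by ring
    have step2a : C'' ^ 2 * (M : ℝ) ^ 6 * aM ^ 4 * ((XF.card : ℝ) * YF.card) ≤
        C'' ^ 2 * ((R + 1) / δ) ^ 6 * aM ^ 4 * ((XF.card : ℝ) * YF.card) :=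
      mul_le_mul_of_nonneg_right (mul_le_mul_of_nonneg_right
        (mul_le_mul_of_nonneg_left hM6 hC2) haM4) hN0
    have step2b : C'' ^ 2 * ((R + 1) / δ) ^ 6 * aM ^ 4 * ((XF.card : ℝ) * YF.card) ≤
        C'' ^ 2 * (((R + 1) / h) ^ 6 * ((XF.card : ℝ) * YF.card)) * aM ^ 4 * ((XF.card : ℝ) * YF.card) := by
      rw [key]
      exact mul_le_mul_of_nonneg_right (mul_le_mul_of_nonneg_right
        (mul_le_mul_of_nonneg_left (mul_le_mul_of_nonneg_left hXY hRh) hC2) haM4) hN0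
    have e3 : C'' ^ 2 * (((R + 1) / h) ^ 6 * ((XF.card : ℝ) * YF.card)) * aM ^ 4 * ((XF.card : ℝ) * YF.card)
        = B * ((XF.card : ℝ) * YF.card * (c' * aM ^ 2)) ^ 2 := by
      rw [hB_def]
      field_simp
    have step3 : B * ((XF.card : ℝ) * YF.card * (c' * aM ^ 2)) ^ 2 ≤ B * S ^ 2 :=
      mul_le_mul_of_nonneg_left (pow_le_pow_left₀
        (mul_nonneg hN0 (mul_nonneg hc'.le (sq_nonneg _))) hSlow 2) hB
    exact step1.trans (e0.le.trans (step2a.trans (step2b.trans (e3.le.trans step3))))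
  -- (6) conclusion: `S² ≤ P (2 + B) S²` with `S > 0`
  have hfinal : S ^ 2 ≤ P * (2 + B) * S ^ 2 := by
    calc S ^ 2 ≤ P * (S * S + χX * χY + S * S) := hSMδ
      _ ≤ P * (S * S + B * S ^ 2 + S * S) := mul_le_mul_of_nonneg_left (by linarith [hratio]) hP0
      _ = P * (2 + B) * S ^ 2 := by ring
  have hone : 1 ≤ P * (2 + B) := le_of_mul_le_mul_right (by linarith) (by positivity : 0 < S ^ 2)
  show 1 / (2 + B) ≤ P
  rwa [div_le_iff₀ (by positivity : (0:ℝ) < 2 + B)]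

end Summit.CriticalPhenomena.Ising3DConformalLimit.Cruxes.ArmDressingGlue.CrossPos

end
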